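import Literature.Computability.Cryptography.ChenQuantumLWELemma38
import Literature.Computability.Cryptography.ChenQuantumLWEEq41Bound
import Mathlib.Data.Matrix.Mul

/-!
# Plancherel for Chen's `QFT` and the Born-rule form of the Step-9 verdict (every branch)

REPRODUCTION / ANALYSIS OF A CLAIMED RESULT UNDER ADJUDICATION (withdrawn): Yilei Chen, *Quantum
Algorithms for Lattice Problems*, IACR ePrint 2024/555, version of 2024-04-18 [ChenQuantumLattice2024],
Step 9 (§3.5.9, pp. 34–38), Lemma 3.8 (p. 26) and eq. (41) (pp. 37–38): the measured `u ∈ ℤ_{M/2}^{n+1}`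
satisfies `u₁ + ⟨b*[2..n+1], u[2..n+1]⟩ ≡ 0 (mod p₁p′)` ALWAYS.  Bundle
`papers/QuantumAdvantage/lwe-quantum-autopsy/` (Part 1, `STEPS.md` §4.4(c)–(d)).  HONEST FRAMING: kernel-checked
THEOREMS about the measurement statistics of a WITHDRAWN algorithm — a precise negative result, NOT summit
progress, no cryptanalytic claim in either direction; quantum lower bounds are out of scope.

What the sibling modules prove in the language of unnormalised Born WEIGHTS (`ChenQuantumLWEOutputLaw`:
the weight of `(x′, u′)` is `w(x′)·Q`; `ChenQuantumLWECountingLaw`: eq. (41) mod `Q` holds on exactly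
`1/Q` of the weight at every coordinate-`0` outcome; `ChenQuantumLWEEq41Bound`: eq. (41) itself on at most
`1/Q`; `ChenQuantumLWELemma38`: certainty forces `QFT (processed K) = 0`) is restated here as statements
about PROBABILITIES and about EVERY BRANCH that can occur:

* `qft_apply_eq_sum_stdAddChar`, `sum_stdAddChar_linForm`, `qft_norm_sq_sum` — Chen's `QFT_{ℤ_mⁿ}`
  (Lemma 2.12, unnormalised, sign `-`) in terms of `ZMod.stdAddChar`, orthogonality of characters on
  `ℤ_mⁿ`, and PLANCHEREL: `Σ_u ‖QFT ψ (u)‖² = mⁿ · Σ_z ‖ψ z‖²`; hence `qft_eq_zero_iff : QFT ψ = 0 ↔ ψ = 0`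
  (Lemma 2.12's `QFT` is unitary after division by `m^{n/2}`).
* `Shape.not_lemma38Certainty_processed` — for every admissible shape with the Bezout witness of
  `ChenQuantumLWECountingLaw` (true for Chen's `b*` by eq. (39)) and EVERY kernel `K` on coordinate `0` with
  `processed K ≠ 0` — i.e. every unitary replacement of (9.e)–(9.g), and every measurement branch that
  occurs with non-zero probability — Lemma 3.8's certainty claim `Shape.Lemma38Certainty (processed K)` is
  FALSE.  (`ChenQuantumLWELemma38` had the instance `K = 1` unconditionally and, for general `K`, only the
  conclusion `QFT (processed K) = 0`; Plancherel closes that gap.)  Corollaries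
  `Shape.not_lemma38Certainty_of_injective` (any `K` injective on `ℂ^{ℤ_N}`) and
  `Shape.not_lemma38Certainty_of_star_mul_self` (any isometry `Kᴴ K = 1`, in particular any unitary),
  via `Shape.processed_eq_zero_iff` (`processed K = 0 ↔ K|A⟩ = 0`, `|A⟩` the coordinate-`0` factor of the
  product state `|φ8.f⟩ = |A⟩ ⊗ |B⟩`) and `Shape.headKet_ne_zero`.
* `Shape.qft_processed_cons` — the full `QFT` of `processed K` is `qftTail` after the composed kernel
  `fourierKernel K` (the bridge used silently inside `Shape.qft_processed_weight`), so every `qftTail`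
  theorem of the sibling modules applies to the actual final measurement of Step 9.
* `Shape.weight_tailResidue_fibre_mul`, `Shape.prob_tailResidue_fibre` — BORN RULE: on every branch
  (`processed K ≠ 0`), for every assignment `γ` of a target residue to each coordinate-`0` outcome,
  `Pr[⟨b*[1..n], u[1..n]⟩ ≡ γ(u₀) (mod Q)] = 1/Q` EXACTLY (normalised probability, total weight
  `N^{n+1}·‖processed K‖² > 0` by Plancherel); `Shape.prob_eq41_le` — `Pr[eq. (41)] ≤ 1/Q ≤ 1/3` on every
  branch, against the claimed `Pr = 1`.

Not here: anything about Steps 1–8; the value of `Pr[eq. (41)]` for a SPECIFIC `K` (for Chen's own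
(9.e)–(9.h) the factor `[u₀ ≡ 0 (mod p₁)]` holds trivially and `Pr[(41)] = 1/Q` exactly, `STEPS.md` §4.4(d),
toy-certified in `numerics/step9_exact/`; the withdrawn (9.e) cannot be performed as displayed,
`Shape.not_step9Display`).
-/

namespace Literature.Computability.Cryptography.Chen2024

open scoped BigOperators

/-! ### Chen's `QFT` through the standard additive character; Plancherel -/

/-- `QFT ψ (u) = Σ_z ψ(z) ψ_m(-⟨z,u⟩)` with `ψ_m = ZMod.stdAddChar` (Lemma 2.12, unnormalised, sign `-`).
[cite: ChenQuantumLattice2024, Lemma 2.12 p. 12] -/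
theorem qft_apply_eq_sum_stdAddChar {n m : ℕ} [NeZero m] (ψ : Ket n m) (u : Fin n → ZMod m) :
    qft ψ u = ∑ z, ψ z * ZMod.stdAddChar (-(∑ t, z t * u t)) := by
  unfold qft
  refine Finset.sum_congr rfl fun z _ => ?_
  congr 1
  rw [show (∑ i, (z i).val * (u i).val : ℕ) = dotVal z u from rfl, e_neg_natCast_div, natCast_dotVal]

/-- **Orthogonality of characters on `ℤ_mⁿ`:** `Σ_{u ∈ ℤ_mⁿ} ψ_m(Σ_t c_t u_t) = mⁿ·[c = 0]`. [folklore] -/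
theorem sum_stdAddChar_linForm {n m : ℕ} [NeZero m] (c : Fin n → ZMod m) :
    ∑ u : Fin n → ZMod m, ZMod.stdAddChar (∑ t, c t * u t) = if c = 0 then ((m : ℂ)) ^ n else 0 := by
  classical
  -- a character turns sums into products
  have hprod : ∀ u : Fin n → ZMod m,
      ZMod.stdAddChar (∑ t, c t * u t) = ∏ t, ZMod.stdAddChar (c t * u t) := by
    intro u
    induction (Finset.univ : Finset (Fin n)) using Finset.induction_on with
    | empty => simp
    | insert a s ha ih => rw [Finset.sum_insert ha, Finset.prod_insert ha, AddChar.map_add_eq_mul, ih]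
  simp_rw [hprod]
  rw [← Fintype.piFinset_univ, ← Finset.prod_univ_sum (fun _ => (Finset.univ : Finset (ZMod m)))
    (fun t x => ZMod.stdAddChar (c t * x))]
  -- each factor is `m·[c t = 0]`
  have hfac : ∀ t : Fin n, ∑ x : ZMod m, ZMod.stdAddChar (c t * x)
      = if c t = 0 then ((m : ℂ)) else 0 := by
    intro t
    simp_rw [mul_comm (c t)]
    rw [AddChar.sum_mulShift (c t) (ZMod.isPrimitive_stdAddChar m), ZMod.card]
    split_ifs <;> simp
  simp_rw [hfac]
  split_ifs with hc
  · subst hc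
    simp
  · obtain ⟨t, ht⟩ := Function.ne_iff.1 hc
    exact Finset.prod_eq_zero (Finset.mem_univ t) (if_neg ht)

/-- **Plancherel for Chen's unnormalised `QFT`:** `Σ_u ‖QFT ψ (u)‖² = mⁿ · Σ_z ‖ψ z‖²` (Lemma 2.12's
`QFT_{ℤ_mⁿ}` is unitary up to the factor `m^{n/2}`). [cite: ChenQuantumLattice2024, Lemma 2.12 p. 12] -/
theorem qft_norm_sq_sum {n m : ℕ} [NeZero m] (ψ : Ket n m) :
    ∑ u, ‖qft ψ u‖ ^ 2 = ((m : ℝ)) ^ n * ∑ z, ‖ψ z‖ ^ 2 := by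
  classical
  set χ := ZMod.stdAddChar (N := m) with hχ
  have key : ∑ u, (starRingEnd ℂ) (qft ψ u) * qft ψ u
      = ((m : ℂ)) ^ n * ∑ z, (starRingEnd ℂ) (ψ z) * ψ z := by
    calc ∑ u, (starRingEnd ℂ) (qft ψ u) * qft ψ u
        = ∑ u : Fin n → ZMod m, ∑ z : Fin n → ZMod m, ∑ z' : Fin n → ZMod m,
            (starRingEnd ℂ) (ψ z) * ψ z' * χ (∑ t, (z' t - z t) * -u t) := by
          refine Finset.sum_congr rfl fun u _ => ?_
          rw [qft_apply_eq_sum_stdAddChar, map_sum, Finset.sum_mul_sum]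
          refine Finset.sum_congr rfl fun z _ => Finset.sum_congr rfl fun z' _ => ?_
          rw [map_mul, ← AddChar.map_neg_eq_conj, mul_mul_mul_comm, ← AddChar.map_add_eq_mul]
          congr 2
          rw [neg_neg, ← Finset.sum_neg_distrib, ← Finset.sum_add_distrib]
          exact Finset.sum_congr rfl fun t _ => by ring
      _ = ∑ z : Fin n → ZMod m, ∑ z' : Fin n → ZMod m, (starRingEnd ℂ) (ψ z) * ψ z'
            * ∑ u : Fin n → ZMod m, χ (∑ t, (z' t - z t) * -u t) := by
          rw [Finset.sum_comm]
          refine Finset.sum_congr rfl fun z _ => ?_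
          rw [Finset.sum_comm]
          refine Finset.sum_congr rfl fun z' _ => ?_
          rw [Finset.mul_sum]
      _ = ∑ z : Fin n → ZMod m, ∑ z' : Fin n → ZMod m, (starRingEnd ℂ) (ψ z) * ψ z'
            * (if z' - z = 0 then ((m : ℂ)) ^ n else 0) := by
          refine Finset.sum_congr rfl fun z _ => Finset.sum_congr rfl fun z' _ => ?_
          congr 1
          have h := sum_stdAddChar_linForm (z' - z)
          simp only [Pi.sub_apply] at h
          rw [← h]
          exact (Fintype.sum_equiv (Equiv.neg _) _ _ fun u => by simp [hχ]).symm
      _ = ((m : ℂ)) ^ n * ∑ z, (starRingEnd ℂ) (ψ z) * ψ z := by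
          rw [Finset.mul_sum]
          refine Finset.sum_congr rfl fun z _ => ?_
          simp_rw [sub_eq_zero, mul_ite, mul_zero]
          rw [Finset.sum_ite_eq' Finset.univ z]
          simp only [Finset.mem_univ, if_true]
          ring
  simp_rw [Complex.conj_mul'] at key
  exact_mod_cast key

/-- `QFT` is injective: `QFT ψ = 0 ↔ ψ = 0`. [cite: ChenQuantumLattice2024, Lemma 2.12 p. 12] -/
theorem qft_eq_zero_iff {n m : ℕ} [NeZero m] (ψ : Ket n m) : qft ψ = 0 ↔ ψ = 0 := by
  constructor
  · intro h
    have hs := qft_norm_sq_sum ψ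
    rw [h] at hs
    simp only [Pi.zero_apply, norm_zero, zero_pow two_ne_zero, Finset.sum_const_zero] at hs
    have hm : ((m : ℝ)) ^ n ≠ 0 := pow_ne_zero _ (Nat.cast_ne_zero.2 (NeZero.ne m))
    have hsum : ∑ z, ‖ψ z‖ ^ 2 = 0 := (mul_eq_zero.1 hs.symm).resolve_left hm
    funext z
    have hz := (Finset.sum_eq_zero_iff_of_nonneg fun z _ => sq_nonneg ‖ψ z‖).1 hsum z (Finset.mem_univ z)
    exact norm_eq_zero.1 ((pow_eq_zero_iff two_ne_zero).1 hz)
  · rintro rfl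
    funext u
    simp [qft]

/-- Positivity form: a non-zero state has positive total weight after `QFT`. [folklore] -/
theorem qft_norm_sq_sum_pos {n m : ℕ} [NeZero m] (ψ : Ket n m) (hψ : ψ ≠ 0) :
    0 < ∑ u, ‖qft ψ u‖ ^ 2 := by
  rcases (Finset.sum_nonneg fun u (_ : u ∈ Finset.univ) => sq_nonneg ‖qft ψ u‖).lt_or_eq with hlt | heq
  · exact hlt
  · exfalso
    apply hψ
    rw [← qft_eq_zero_iff]
    funext u
    have hz := (Finset.sum_eq_zero_iff_of_nonneg fun u _ => sq_nonneg ‖qft ψ u‖).1 heq.symm u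
      (Finset.mem_univ u)
    exact norm_eq_zero.1 ((pow_eq_zero_iff two_ne_zero).1 hz)

/-! ### Every branch of every processing of coordinate 0 -/

namespace Shape

variable (S : Shape)

/-- The CRT certificate of `|φ8.f⟩` for an admissible shape (`phi8fCertificate` with the shape's data):
the factors `|A⟩` (`headKet`) and `|B⟩` (`tailKet`). [cite: ChenQuantumLattice2024, eq. (39)–(40) p. 36] -/
noncomputable def Admissible.cert {S : Shape} (h : S.Admissible) : Certificate S.chirped S.p₁ S.Q :=
  phi8fCertificate S.n S.D S.p₁ S.Q S.bstar S.vstar h.cop_pQ (by rw [h.bstar_head]) h.bstar_tail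

/-- `⟨x, y′ | φ8.f⟩ = A(x)·B(y′)` with the certified factors. [cite: ChenQuantumLattice2024, eq. (40) p. 36] -/
theorem phi8f_cons (h : S.Admissible) (x : ZMod S.N) (y' : Fin S.n → ZMod S.N) :
    S.phi8f (Fin.cons x y') = h.cert.headKet x * h.cert.tailKet y' := by
  rw [S.phi8f_eq_ket]
  exact h.cert.splitFirst_ket x y'

/-- `processed K` is `(K|A⟩) ⊗ |B⟩`: `(processed K)(x | y′) = (Σ_y K x y · A y) · B y′`.
[cite: ChenQuantumLattice2024, §3.5.9 (9.e)–(9.g) pp. 37–38] -/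
theorem processed_cons (h : S.Admissible) (K : ZMod S.N → ZMod S.N → ℂ) (x : ZMod S.N)
    (y' : Fin S.n → ZMod S.N) :
    S.processed K (Fin.cons x y') = (∑ y, K x y * h.cert.headKet y) * h.cert.tailKet y' := by
  simp only [Shape.processed, Fin.cons_zero, Fin.tail_cons, S.phi8f_cons h, ← mul_assoc,
    Finset.sum_mul]

/-- `|φ8.f⟩ ≠ 0` (its total amplitude is the chirp sum `G`, `‖G‖² = P`). [cite: ChenQuantumLattice2024, eq. (40) p. 36] -/
theorem phi8f_ne_zero (h : S.Admissible) : S.phi8f ≠ 0 := by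
  intro h0
  have h1 := S.sum_phi8f
  rw [h0] at h1
  simp only [Pi.zero_apply, Finset.sum_const_zero] at h1
  have h2 := S.norm_sq_chirpSum h
  rw [← h1, norm_zero, zero_pow two_ne_zero] at h2
  exact (NeZero.ne (S.P : ℕ)) (by exact_mod_cast h2.symm)

/-- The coordinate-`0` factor `|A⟩` is non-zero. [cite: ChenQuantumLattice2024, eq. (40) p. 36] -/
theorem headKet_ne_zero (h : S.Admissible) : h.cert.headKet ≠ 0 := by
  intro h0
  apply S.phi8f_ne_zero h
  funext z
  have hz : S.phi8f z = h.cert.headKet (z 0) * h.cert.tailKet (Fin.tail z) := by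
    rw [← S.phi8f_cons h, Fin.cons_self_tail]
  have hx : h.cert.headKet (z 0) = 0 := by rw [h0]; rfl
  rw [hz, hx, zero_mul, Pi.zero_apply]

/-- The coordinates-`1..n` factor `|B⟩` is non-zero. [cite: ChenQuantumLattice2024, eq. (40) p. 36] -/
theorem tailKet_ne_zero (h : S.Admissible) : h.cert.tailKet ≠ 0 := by
  intro h0
  apply S.phi8f_ne_zero h
  funext z
  have hz : S.phi8f z = h.cert.headKet (z 0) * h.cert.tailKet (Fin.tail z) := by
    rw [← S.phi8f_cons h, Fin.cons_self_tail]
  have hy : h.cert.tailKet (Fin.tail z) = 0 := by rw [h0]; rfl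
  rw [hz, hy, mul_zero, Pi.zero_apply]

/-- **A branch is null iff it kills `|A⟩`:** `processed K = 0 ↔ K|A⟩ = 0`.
[cite: ChenQuantumLattice2024, §3.5.9 (9.e)–(9.g) pp. 37–38] -/
theorem processed_eq_zero_iff (h : S.Admissible) (K : ZMod S.N → ZMod S.N → ℂ) :
    S.processed K = 0 ↔ (fun x => ∑ y, K x y * h.cert.headKet y) = 0 := by
  constructor
  · intro h0
    obtain ⟨y', hy'⟩ : ∃ y', h.cert.tailKet y' ≠ 0 := Function.ne_iff.1 (S.tailKet_ne_zero h)
    funext x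
    have hx := congrFun h0 (Fin.cons x y')
    rw [S.processed_cons h, Pi.zero_apply, mul_eq_zero] at hx
    exact hx.resolve_right hy'
  · intro h0
    funext z
    rw [← Fin.cons_self_tail z, S.processed_cons h, congrFun h0 (z 0), Pi.zero_apply, zero_mul,
      Pi.zero_apply]

/-- **Lemma 3.8's certainty claim fails on every branch that occurs.**  For every admissible shape with a
Bezout witness for `b*[1..n] mod Q` and every kernel `K` on coordinate `0` with `processed K ≠ 0`:
`¬ Lemma38Certainty (processed K)`.  (`lemma38Certainty_forces_null` gives `QFT (processed K) = 0`;
Plancherel makes that `processed K = 0`.) [cite: ChenQuantumLattice2024, Lemma 3.8 p. 26; eq. (41) p. 38] -/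
theorem not_lemma38Certainty_processed (h : S.Admissible) (K : ZMod S.N → ZMod S.N → ℂ)
    (w : Fin S.n → ℤ) (hw : ((∑ t, w t * S.bstar (Fin.succ t) : ℤ) : ZMod S.Q) = 1)
    (hK : S.processed K ≠ 0) : ¬ S.Lemma38Certainty (S.processed K) := fun hL =>
  hK ((qft_eq_zero_iff _).1 (S.lemma38Certainty_forces_null h K w hw hL))

/-- Corollary: any `K` injective on `ℂ^{ℤ_N}` (no branch selection) refutes the certainty claim.
[cite: ChenQuantumLattice2024, Lemma 3.8 p. 26; eq. (41) p. 38] -/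
theorem not_lemma38Certainty_of_injective (h : S.Admissible) (K : ZMod S.N → ZMod S.N → ℂ)
    (w : Fin S.n → ℤ) (hw : ((∑ t, w t * S.bstar (Fin.succ t) : ℤ) : ZMod S.Q) = 1)
    (hK : ∀ f : ZMod S.N → ℂ, (fun x => ∑ y, K x y * f y) = 0 → f = 0) :
    ¬ S.Lemma38Certainty (S.processed K) :=
  S.not_lemma38Certainty_processed h K w hw fun h0 =>
    S.headKet_ne_zero h (hK _ ((S.processed_eq_zero_iff h K).1 h0))

/-- Corollary: any ISOMETRY on coordinate `0` (`Kᴴ K = 1`; every unitary, `unitary.star_mul_self_of_mem`)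
refutes the certainty claim — this covers every coherent replacement of (9.e)–(9.g).
[cite: ChenQuantumLattice2024, Lemma 3.8 p. 26; eq. (41) p. 38] -/
theorem not_lemma38Certainty_of_star_mul_self (h : S.Admissible)
    (K : Matrix (ZMod S.N) (ZMod S.N) ℂ) (hK : star K * K = 1)
    (w : Fin S.n → ℤ) (hw : ((∑ t, w t * S.bstar (Fin.succ t) : ℤ) : ZMod S.Q) = 1) :
    ¬ S.Lemma38Certainty (S.processed K) := by
  refine S.not_lemma38Certainty_of_injective h K w hw fun f hf => ?_
  have hmv : K.mulVec f = 0 := by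
    rw [← hf]
    rfl
  calc f = (star K * K).mulVec f := by rw [hK, Matrix.one_mulVec]
    _ = 0 := by rw [← Matrix.mulVec_mulVec, hmv, Matrix.mulVec_zero]

/-! ### The Born rule: probabilities, not weights -/

/-- The kernel on coordinate `0` obtained by composing `K` with the coordinate-`0` Fourier kernel of the
final `QFT` (9.h): `(u₀, y) ↦ Σ_x e(-x u₀/N) K x y`. [cite: ChenQuantumLattice2024, Lemma 2.12 p. 12; (9.h) p. 38] -/
noncomputable def fourierKernel (K : ZMod S.N → ZMod S.N → ℂ) : ZMod S.N → ZMod S.N → ℂ :=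
  fun u₀ y => ∑ x : ZMod S.N, e (-(((x.val * u₀.val : ℕ) : ℚ) / S.N)) * K x y

/-- The final measurement of Step 9 in `qftTail` form: `QFT (processed K) (u₀ | u′) =
qftTail ((fourierKernel K)·|φ8.f⟩) (u₀, u′)`. [cite: ChenQuantumLattice2024, Lemma 2.12 p. 12; (9.h) p. 38] -/
theorem qft_processed_cons (K : ZMod S.N → ZMod S.N → ℂ) (u₀ : ZMod S.N) (u' : Fin S.n → ZMod S.N) :
    qft (S.processed K) (Fin.cons u₀ u')
      = qftTail (fun z : ZMod S.N × (Fin S.n → ZMod S.N) =>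
          ∑ y, S.fourierKernel K z.1 y * splitFirst S.phi8f (y, z.2)) (u₀, u') := by
  have h1 : qft (S.processed K) (Fin.cons u₀ u')
      = qftTail (fun z : ZMod S.N × (Fin S.n → ZMod S.N) =>
          ∑ x : ZMod S.N, e (-(((x.val * z.1.val : ℕ) : ℚ) / S.N)) * splitFirst (S.processed K) (x, z.2))
          (u₀, u') :=
    splitFirst_qft (S.processed K) u₀ u'
  have h2 : (fun z : ZMod S.N × (Fin S.n → ZMod S.N) =>
          ∑ x : ZMod S.N, e (-(((x.val * z.1.val : ℕ) : ℚ) / S.N)) * splitFirst (S.processed K) (x, z.2))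
      = fun z : ZMod S.N × (Fin S.n → ZMod S.N) =>
          ∑ y : ZMod S.N, S.fourierKernel K z.1 y * splitFirst S.phi8f (y, z.2) := by
    funext z
    simp only [splitFirst, Shape.processed, Shape.fourierKernel, Fin.cons_zero, Fin.tail_cons,
      Finset.mul_sum, Finset.sum_mul]
    rw [Finset.sum_comm]
    refine Finset.sum_congr rfl fun y _ => Finset.sum_congr rfl fun x _ => ?_
    ring
  rw [h1, h2]

/-- A sum over `ℤ_N^{n+1}` split as coordinate `0` and the rest. [folklore] -/
theorem sum_cons {N : ℕ} [NeZero N] (f : (Fin (S.n + 1) → ZMod N) → ℝ) :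
    ∑ u, f u = ∑ u₀ : ZMod N, ∑ u' : Fin S.n → ZMod N, f (Fin.cons u₀ u') := by
  rw [← (Fin.consEquiv fun _ => ZMod N).sum_comp f, Fintype.sum_prod_type]
  rfl

/-- **Total weight of a branch** (Plancherel): `Σ_u ‖QFT (processed K) u‖² = N^{n+1} Σ_z ‖processed K z‖²`;
positive iff the branch occurs. [cite: ChenQuantumLattice2024, Lemma 2.12 p. 12] -/
theorem qft_processed_norm_sq_sum (K : ZMod S.N → ZMod S.N → ℂ) :
    ∑ u, ‖qft (S.processed K) u‖ ^ 2 = ((S.N : ℕ) : ℝ) ^ (S.n + 1) * ∑ z, ‖S.processed K z‖ ^ 2 :=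
  qft_norm_sq_sum (S.processed K)

/-- **Weight form of the `1/Q` law for the actual final measurement.**  For every kernel `K` on
coordinate `0` and every target residue `γ(u₀) ∈ ℤ_Q` per coordinate-`0` outcome:
`(Σ_{u : ⟨b*[1..n],u[1..n]⟩ ≡ γ(u₀) (mod Q)} ‖QFT (processed K) u‖²)·Q = Σ_u ‖QFT (processed K) u‖²`.
[cite: ChenQuantumLattice2024, §3.5.9 pp. 37–38, eq. (41)] -/
theorem weight_tailResidue_fibre_mul (h : S.Admissible) (K : ZMod S.N → ZMod S.N → ℂ)
    (w : Fin S.n → ℤ) (hw : ((∑ t, w t * S.bstar (Fin.succ t) : ℤ) : ZMod S.Q) = 1)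
    (γ : ZMod S.N → ZMod S.Q) :
    (∑ u ∈ Finset.univ.filter (fun u : Fin (S.n + 1) → ZMod S.N => S.tailResidue (Fin.tail u) = γ (u 0)),
        ‖qft (S.processed K) u‖ ^ 2) * S.Q
      = ∑ u, ‖qft (S.processed K) u‖ ^ 2 := by
  rw [Finset.sum_filter, S.sum_cons, S.sum_cons, Finset.sum_mul]
  refine Finset.sum_congr rfl fun u₀ _ => ?_
  simp only [Fin.cons_zero, Fin.tail_cons]
  rw [← Finset.sum_filter]
  simp_rw [S.qft_processed_cons K]
  exact S.eq41_modQ_fraction h (S.fourierKernel K) u₀ w hw (γ u₀)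

/-- **Born rule, every branch: `Pr[⟨b*[1..n], u[1..n]⟩ ≡ γ(u₀) (mod Q)] = 1/Q` exactly** — for every
admissible shape with the Bezout witness, every kernel `K` on coordinate `0` whose branch occurs
(`processed K ≠ 0`), and every residue assignment `γ`.  In particular `u[1..n] mod Q` is never determined
by `u₀`, contrary to eq. (41) "always". [cite: ChenQuantumLattice2024, Lemma 3.8 p. 26; eq. (41) p. 38] -/
theorem prob_tailResidue_fibre (h : S.Admissible) (K : ZMod S.N → ZMod S.N → ℂ)
    (w : Fin S.n → ℤ) (hw : ((∑ t, w t * S.bstar (Fin.succ t) : ℤ) : ZMod S.Q) = 1)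
    (γ : ZMod S.N → ZMod S.Q) (hK : S.processed K ≠ 0) :
    (∑ u ∈ Finset.univ.filter (fun u : Fin (S.n + 1) → ZMod S.N => S.tailResidue (Fin.tail u) = γ (u 0)),
        ‖qft (S.processed K) u‖ ^ 2) / ∑ u, ‖qft (S.processed K) u‖ ^ 2 = 1 / S.Q := by
  have htot : 0 < ∑ u, ‖qft (S.processed K) u‖ ^ 2 := qft_norm_sq_sum_pos _ hK
  have hQ : (0 : ℝ) < S.Q := by exact_mod_cast S.Q.pos
  rw [div_eq_div_iff htot.ne' hQ.ne', one_mul]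
  exact S.weight_tailResidue_fibre_mul h K w hw γ

/-- **Born rule, every branch: `Pr[eq. (41)] ≤ 1/Q`** (`Q = p′ ≥ 3`), for every admissible shape with the
Bezout witness and every kernel `K` on coordinate `0` whose branch occurs — Chen's Lemma 3.8 / Step 9
claimed `Pr[eq. (41)] = 1`. [cite: ChenQuantumLattice2024, Lemma 3.8 p. 26; eq. (41) p. 38] -/
theorem prob_eq41_le (h : S.Admissible) [DecidablePred S.eq41] (K : ZMod S.N → ZMod S.N → ℂ)
    (w : Fin S.n → ℤ) (hw : ((∑ t, w t * S.bstar (Fin.succ t) : ℤ) : ZMod S.Q) = 1)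
    (hK : S.processed K ≠ 0) :
    (∑ u ∈ Finset.univ.filter S.eq41, ‖qft (S.processed K) u‖ ^ 2)
        / ∑ u, ‖qft (S.processed K) u‖ ^ 2 ≤ 1 / S.Q := by
  have htot : 0 < ∑ u, ‖qft (S.processed K) u‖ ^ 2 := qft_norm_sq_sum_pos _ hK
  rw [← S.prob_tailResidue_fibre h K w hw (fun u₀ => -(((u₀.val : ℕ)) : ZMod S.Q)) hK]
  refine div_le_div_of_nonneg_right ?_ htot.le
  refine Finset.sum_le_sum_of_subset_of_nonneg (fun u hu => ?_) (fun _ _ _ => by positivity)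
  rw [Finset.mem_filter] at hu ⊢
  refine ⟨hu.1, ?_⟩
  have h41 : S.eq41 (Fin.cons (u 0) (Fin.tail u)) := by rw [Fin.cons_self_tail]; exact hu.2
  exact S.tailResidue_eq_of_eq41 (u 0) (Fin.tail u) h41

end Shape

end Literature.Computability.Cryptography.Chen2024
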